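import Mathlib.Algebra.Field.ZMod
import Mathlib.LinearAlgebra.Basis.Basic
import Mathlib.LinearAlgebra.Basis.VectorSpace

/-!
# ω-census, family (b3): conjecture C9 (b) — functionals with prescribed values on independent vectors (glue for the box theorems)

HONEST FRAMING (pub-omega census; verbatim): lottery ticket; floor = certified bounds/negative ranges.
Census BOOKKEEPING (conjecture C9 of the cell, STRUCTURE.md §2, `BoxRatioSectionLaw`; pub-omega stpp-1 gen 23, the atom lane).
Nothing here is progress on `ω`.

The box theorems `TwoGen.not_boxUseful` (`TwoGenBoxMain`), `PowBox.not_boxUseful_p` (`PowBoxSmall`) and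
`PowBox.not_boxUseful_13_k2` (`PowBoxK2`) take their linear-independence hypothesis in FUNCTIONAL form («every value vector
on `x, u x, …, u^E x` is realised by an additive `λ : R → 𝔽_p`»), which is what the proofs consume and which avoids fixing a
`ZMod p`-module structure on the ring.  This file provides the standard translation from linear independence over a field:
`exists_addMonoidHom_of_linearIndependent` (prescribed values on any linearly independent family are realised by an additive
functional — basis of the span, `Module.Basis.constr`, `LinearMap.exists_extend`), and the three shapes used by the box theorems:
`fun_powers_of_linearIndependent` (powers `u^e x`, `e ≤ E`), `fun_pair_of_linearIndependent` (values on `x, u x`) and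
`fun_two_of_linearIndependent` (`λ₀ (u x) = 0 ≠ λ₀ x`).  Pure linear algebra.
-/

namespace Summit.MatrixMultiplication.OmegaCensus

namespace PowBox

open Submodule

/-- Prescribed values on a linearly independent family over a field are realised by an additive functional. [folklore] -/
theorem exists_addMonoidHom_of_linearIndependent {K : Type*} [Field K] {M : Type*} [AddCommGroup M] [Module K M]
    {ι : Type*} {v : ι → M} (hv : LinearIndependent K v) (t : ι → K) : ∃ lam : M →+ K, ∀ i, lam (v i) = t i := by
  classical
  let b := Module.Basis.span hv
  let f : span K (Set.range v) →ₗ[K] K := b.constr K t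
  obtain ⟨g, hg⟩ := LinearMap.exists_extend f
  refine ⟨g.toAddMonoidHom, fun i => ?_⟩
  have h1 : g (v i) = f (b i) := by
    have := LinearMap.congr_fun hg (b i)
    rw [LinearMap.comp_apply, Submodule.subtype_apply] at this
    rw [← this, Module.Basis.coe_span_apply]
  rw [LinearMap.toAddMonoidHom_coe, h1]
  exact b.constr_basis K t i

variable {p : ℕ} [Fact p.Prime] {R : Type*} [CommRing R] [Module (ZMod p) R]

/-- Powers form: if `x, u x, …, u^E x` are `𝔽_p`-linearly independent (for some `𝔽_p`-module structure on `R`), every value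
vector on them is realised by an additive `λ : R → 𝔽_p`. [folklore] -/
theorem fun_powers_of_linearIndependent (u x : R) (E : ℕ)
    (h : LinearIndependent (ZMod p) (fun e : Fin (E + 1) => u ^ (e : ℕ) * x)) :
    ∀ t : ℕ → ZMod p, ∃ lam : R →+ ZMod p, ∀ e, e ≤ E → lam (u ^ e * x) = t e := by
  intro t
  obtain ⟨lam, hlam⟩ := exists_addMonoidHom_of_linearIndependent h (fun e => t e)
  exact ⟨lam, fun e he => by simpa using hlam ⟨e, Nat.lt_succ_of_le he⟩⟩

/-- Pair form: if `x, u x` are `𝔽_p`-linearly independent, every pair of values on them is realised by an additive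
`λ : R → 𝔽_p`. [folklore] -/
theorem fun_pair_of_linearIndependent (u x : R) (h : LinearIndependent (ZMod p) ![x, u * x]) :
    ∀ t0 t1 : ZMod p, ∃ lam : R →+ ZMod p, lam x = t0 ∧ lam (u * x) = t1 := by
  intro t0 t1
  obtain ⟨lam, hlam⟩ := exists_addMonoidHom_of_linearIndependent h ![t0, t1]
  exact ⟨lam, by simpa using hlam 0, by simpa using hlam 1⟩

/-- Two-generator form: if `x, u x` are `𝔽_p`-linearly independent there is an additive `λ₀ : R → 𝔽_p` with
`λ₀ (u x) = 0 ≠ λ₀ x` (the hypothesis of `TwoGen.not_boxUseful`). [folklore] -/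
theorem fun_two_of_linearIndependent (u x : R) (h : LinearIndependent (ZMod p) ![x, u * x]) :
    ∃ lam : R →+ ZMod p, lam (u * x) = 0 ∧ lam x ≠ 0 := by
  obtain ⟨lam, h0, h1⟩ := fun_pair_of_linearIndependent u x h 1 0
  exact ⟨lam, h1, by rw [h0]; exact one_ne_zero⟩

end PowBox

end Summit.MatrixMultiplication.OmegaCensus
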